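import Literature.Claims.NS.Ruzmaikina2008
import Mathlib.Analysis.Complex.ExponentialBounds
import HarnessLib

/-!
# C25 `Ruzmaikina2008` (D-0090 NS-CLAIMS SWEEP) — the inference (49) ⇒ (50) is false

A. A. Ruzmaikina, *On boundedness, existence and uniqueness of strong solutions of the Navier–Stokes
equations in 3 dimensions*, arXiv:0810.0318v2 (2009), proof of Theorem 2, Part 1, p. 20–21
(TeX l. 369–375): from (49) `ln ln ln ∫|ω|ⁿ(t) ≤ (t − t₁) + ln ln ln ∫|ω|ⁿ(t₁)` the print concludes
(50) `∫|ω|ⁿ(t) ≤ e^{e^{e^{t−t₁}}} ∫|ω|ⁿ(t₁)`.  Un-nesting three logarithms turns the additive shift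
`s = t − t₁` into a tower, `ln ∫|ω|ⁿ(t) ≤ (ln ∫|ω|ⁿ(t₁))^{e^s}`, not into the factor `e^{e^{e^s}}`.

We refute the typed step in its MAXIMALLY CHARITABLE form `Inference50Charitable` (threshold `n₁`
allowed to depend on the horizon `τ` and on two-sided a priori bounds for the norms), hence the
typed locator `Inference50` and the bare display `Inference50Pointwise`.

Witness (pure real arithmetic, no Navier–Stokes object): `τ = s = 1`, `a = A = e^e`,
`b = B = e^{e+1}`, and any `n ≥ max(n₁, 27)`: then `ln ln ln(bⁿ) = ln(ln n + ln(e+1)) ≤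
1 + ln(ln n + 1) = 1 + ln ln ln(aⁿ)` (because `ln(e+1) ≤ e`), while (50) would force
`n(e+1) ≤ e^e + n e`, i.e. `n ≤ e^e < e³ < 27`.

WHAT THIS IS NOT: not a claim about NS regularity or blow-up; not a claim about any author beyond
the typed locator.
-/

set_option linter.dupNamespace false

noncomputable section

open Real

namespace Summit.NavierStokesRegularity.NavierStokesRegularity.Theorems.Ruzmaikina2008

open Literature.Claims.NS.Ruzmaikina2008

/-- `ln ln ln ((e^c)ⁿ) = ln (ln n + ln c)` for `c > 0`, `n ≥ 1`. -/
theorem lll_exp_pow {c : ℝ} (hc : 0 < c) {n : ℕ} (hn : 1 ≤ n) :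
    lll (exp c ^ n) = log (log n + log c) := by
  have hn0 : (n : ℝ) ≠ 0 := by exact_mod_cast (show n ≠ 0 by omega)
  rw [lll, ← Real.exp_nat_mul, log_exp, log_mul hn0 hc.ne']

/-- **The charitable form of Step 5 is false**: even with the exponent threshold allowed to depend on
the horizon and on a priori two-sided bounds for `|ω|_n(t₁)`, `|ω|_n(t)`, the inference (49) ⇒ (50)
fails — fixed `a = e^e`, `b = e^{e+1}`, `s = 1`, and `n → ∞`. -/
theorem not_Inference50Charitable :
    ¬ Literature.Claims.NS.Ruzmaikina2008.Inference50Charitable := by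
  intro H
  obtain ⟨n₁, hn₁⟩ := H 1 (exp (exp 1)) (exp (exp 1 + 1)) one_pos
  set n : ℕ := max n₁ 27 with hn
  have hn27 : 27 ≤ n := le_max_right _ _
  have hn1 : 1 ≤ n := le_trans (by norm_num) hn27
  have hnR : (27 : ℝ) ≤ n := by exact_mod_cast hn27
  have he1 : (2.7182818283 : ℝ) < exp 1 := Real.exp_one_gt_d9
  have hepos : 0 < exp 1 := exp_pos 1
  have hlogn : 0 ≤ log (n : ℝ) := log_natCast_nonneg n
  -- the hypothesis (49) at s = 1 holds for a = e^e, b = e^{e+1}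
  have h49 : lll (exp (exp 1 + 1) ^ n) ≤ 1 + lll (exp (exp 1) ^ n) := by
    rw [lll_exp_pow (by positivity) hn1, lll_exp_pow hepos hn1, log_exp]
    have hle : log (exp 1 + 1) ≤ exp 1 := by
      have := log_le_sub_one_of_pos (show 0 < exp 1 + 1 by positivity); linarith
    have hlpos : 0 < log (exp 1 + 1) := log_pos (by linarith)
    have hL : 0 < log (n : ℝ) + log (exp 1 + 1) := by linarith
    have hR : 0 < log (n : ℝ) + 1 := by linarith
    calc log (log (n : ℝ) + log (exp 1 + 1))
        ≤ log (exp 1 * (log (n : ℝ) + 1)) := by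
          refine log_le_log hL ?_
          nlinarith
      _ = 1 + log (log (n : ℝ) + 1) := by
          rw [log_mul hepos.ne' hR.ne', log_exp]
  have h := hn₁ n (le_max_left _ _) 1 (exp (exp 1)) (exp (exp 1 + 1)) zero_le_one le_rfl le_rfl le_rfl
    (exp_le_exp.mpr (by linarith)) le_rfl h49
  -- (50) would give n (e + 1) ≤ e^e + n e, i.e. n ≤ e^e
  rw [← Real.exp_nat_mul, ← Real.exp_nat_mul, ← exp_add, exp_le_exp] at h
  have hn_le : (n : ℝ) ≤ exp (exp 1) := by nlinarith
  -- `e^e < e³ < 27` (the tree's `Davis1978.exp_exp_one_lt`, inlined to keep the imports fluid-only)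
  have h27 : exp (exp 1) < 27 := by
    have he : exp 1 < (2.7182818286 : ℝ) := Real.exp_one_lt_d9
    have h3 : exp (exp 1) < exp 3 := exp_lt_exp.mpr (by linarith)
    have hcube : exp 3 = exp 1 ^ 3 := by rw [← Real.exp_nat_mul]; norm_num
    have hp3 : exp 1 ^ 3 < (3 : ℝ) ^ 3 := pow_lt_pow_left₀ (by linarith) hepos.le (by norm_num)
    norm_num at hp3
    linarith
  linarith

/-- **Step 5 as typed (the cell's locator) is false.** -/
theorem not_Inference50 : ¬ Literature.Claims.NS.Ruzmaikina2008.Inference50 :=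
  fun h => not_Inference50Charitable (inference50Charitable_of_inference50 h)

/-- The bare display (49) ⇒ (50) is false as well. -/
theorem not_Inference50Pointwise : ¬ Literature.Claims.NS.Ruzmaikina2008.Inference50Pointwise :=
  fun h => not_Inference50 (inference50_of_pointwise h)

end Summit.NavierStokesRegularity.NavierStokesRegularity.Theorems.Ruzmaikina2008

end
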